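import Mathlib.NumberTheory.NumberField.ClassNumber
import Summits.QuantumAdvantage.QuantumAdvantage.Theses.LinnikCubicClassGroups
import Summits.QuantumAdvantage.QuantumAdvantage.Theorems.LinnikCubicClassGroupsPureCubicClassGroupFBQPStubCubicFieldFacts
import Summits.QuantumAdvantage.QuantumAdvantage.Theorems.LinnikCubicClassGroupsPureCubicClassNumberHardStubClassNumberLe
import Summits.QuantumAdvantage.QuantumAdvantage.Theorems.LinnikCubicClassGroupsPureCubicClassNumberHardStubModThreePolyTime
import Summits.QuantumAdvantage.QuantumAdvantage.Theorems.LinnikCubicClassGroupsPureCubicClassNumberHardHondaLeakTransfer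
import Summits.QuantumAdvantage.QuantumAdvantage.Theorems.LinnikCubicClassGroupsPureCubicClassNumberHardStubFieldSetup
import Summits.QuantumAdvantage.QuantumAdvantage.Theorems.LinnikCubicClassGroupsPureCubicClassNumberHardStubRamificationCensus
import Summits.QuantumAdvantage.QuantumAdvantage.Theorems.LinnikCubicClassGroupsPureCubicClassNumberHardStubZetaNotNorm
import Summits.QuantumAdvantage.QuantumAdvantage.Theorems.LinnikCubicClassGroupsPureCubicClassNumberHardStubUnitsNormOne9
import Summits.QuantumAdvantage.QuantumAdvantage.Theorems.LinnikCubicClassGroupsPureCubicClassNumberHardStubInvariantIdealsPrincipal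
import Summits.QuantumAdvantage.QuantumAdvantage.Theorems.LinnikCubicClassGroupsPureCubicClassNumberHardStubClassNumberNotDvd
import Literature.NumberTheory.NumberFields.PureCubicClassNumberModThreeProofs
import Literature.Computability.Complexity.RandomizedProofs
import Literature.Computability.Complexity.StackWordArith
import HarnessLib

/-!
# Honda's criterion on the Φ-hiding promise family, PROVED; `PureCubicClassNumberHard` from Φ-hiding(3) alone

Crux `stmt-QuantumAdvantage-11826` (route `LinnikCubicClassGroups`, rank-0 hypothesis-type target
`X = PureCubicClassNumberHard`), line `Sketch` (honda-leak arm), skeleton v3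
(`Cruxes/PureCubicClassNumberHard/Lines/Sketch.lean`).  The previous transfer
(`pureCubicClassNumberHard_of_honda_of_phiHiding3`, this directory) took TWO leaves: Honda's full
two-prime criterion (named fact `Honda1971_three_dvd_classNumber_twoPrimes`, class field theory)
and worst-case Φ-hiding for `e = 3`.  This file REMOVES the number-theoretic leaf: on the promise
family `{N = pq ≡ 1 (9) : p ≡ q ≡ 1 (3) or {p, q} ≡ {2, 5} (9)}` only two of Honda's three cases are
needed, and both are now theorems of the tree —

* the split case `p ≡ 1 (3)` or `q ≡ 1 (3)` ⟹ `3 ∣ h_K` is the Literature theorem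
  `Honda1971.three_dvd_classNumber_of_mod_three_eq_one` (genus theory on the tree's Artin map for
  unramified cyclic extensions of odd degree);
* the inert case `p ≡ 2, q ≡ 5 (mod 9)` ⟹ `3 ∤ h_K` is `honda25` below — Chevalley's
  ambiguous-class argument for the cyclic cubic `L = K(ζ₃) / F = ℚ(ζ₃)`, assembled from the six
  landed stub files of the skeleton (`…StubFieldSetup`: the Kummer set-up and the totally ramified
  primes above `p, q`; `…StubRamificationCensus`: no other prime of `F` ramifies — Dedekind species
  2, `pq ≡ 1 (mod 9)`; `…StubZetaNotNorm`: `ζ₃` is not a norm from `L`, local obstruction at the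
  inert `p`; `…StubUnitsNormOne9`: nine norm-one units inequivalent modulo `σ`-coboundaries from
  the tree's unit Herbrand quotient; `…StubInvariantIdealsPrincipal`: `σ`-invariant ideals are
  principal; `…StubClassNumberNotDvd`: invariant classes contain invariant ideals (Hilbert 90), and
  a `3`-cycle on `Cl(L)` with one fixed point forces `3 ∤ h_L`) and the tree's ascent
  `3 ∣ h_K ⟹ 3 ∣ h_L` (`Honda1971.dvd_classNumber_of_dvd_classNumber_of_not_dvd_finrank`).

Consequently `three_dvd_classNumber_iff_of_promise` (the idea card's `HondaSplitVsInert`: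
`3 ∣ h(ℚ(∛pq)) ↔ p ≡ 1 (mod 3)` on the promise family) holds unconditionally, the reduction
`eisensteinTypeDecider_of_classNumberAlgorithm'` needs no hypothesis, and
**`pureCubicClassNumberHard_of_phiHiding3`**: the crux follows from the single, standard-shaped
hardness hypothesis "worst-case Φ-hiding for `e = 3` on the pure-cubic promise family" (an
explicit hypothesis `hΦ`, NOT asserted: conjecture-grade, its failure is a PPT algorithm deciding
`3 ∣ φ(N)` for RSA moduli `N ≡ 1 (mod 9)`; cf. Cachin–Micali–Stadler 1999 §2).

## References

* T. Honda, *Pure cubic fields whose class numbers are multiples of three*, J. Number Theory 3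
  (1971) 7–12, Theorem. [Honda1971]
* S. Aouissi, D. C. Mayer, M. C. Ismaili, M. Talbi, A. Azizi, *3-rank of ambiguous class groups of
  cubic Kummer extensions*, Period. Math. Hungar. 81 (2020), Thm. 2.3. [AouissiMayerIsmailiTalbiAzizi2020]
* C. Chevalley, *Sur la théorie du corps de classes dans les corps finis et les corps locaux*,
  J. Fac. Sci. Tokyo 2 (1933) (ambiguous class number formula). [folklore]
* C. Cachin, S. Micali, M. Stadler, EUROCRYPT '99, LNCS 1592, §2 (Φ-Hiding Assumption).
  [CachinMicaliStadler1999]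
-/

set_option linter.dupNamespace false

open scoped Pointwise NumberField

namespace Summit.QuantumAdvantage.QuantumAdvantage.Theorems.LinnikCubicClassGroups

open Literature.Computability.Complexity _root_.Computability NumberField

/-! ### The (2,5)-direction of Honda's criterion -/

/-- Norms meeting the units of `F`: if `ζ` is not a norm from the cubic extension `L/F` and every
unit of `F` is `±ζ^i` (with `ζ³ = 1`), then an element of `L` whose norm is a unit of `F` has norm
`±1`, i.e. the norm of the unit `±1` of `L`. [folklore] -/
theorem honda25_norm_unit
    (F L : Type) [Field F] [NumberField F] [Field L] [NumberField L] [Algebra F L]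
    (h3 : Module.finrank F L = 3)
    (ζ : (𝓞 F)ˣ) (hζ3 : ((ζ : 𝓞 F) : F) ^ 3 = 1)
    (hunits : ∀ w : (𝓞 F)ˣ, ∃ i : ℕ, w = ζ ^ i ∨ w = -ζ ^ i)
    (hnn : ∀ x : L, Algebra.norm F x ≠ ((ζ : 𝓞 F) : F)) :
    ∀ x : L, (∃ u : (𝓞 F)ˣ, Algebra.norm F x = ((u : 𝓞 F) : F)) →
      ∃ ε : (𝓞 L)ˣ, Algebra.norm F (((ε : 𝓞 L) : L)) = Algebra.norm F x := by
  intro x ⟨u, hu⟩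
  obtain ⟨i, hi⟩ := hunits u
  set z : F := ((ζ : 𝓞 F) : F) with hz
  have hzpow : ∀ n : ℕ, (((ζ ^ n : (𝓞 F)ˣ) : 𝓞 F) : F) = z ^ n := by
    intro n; simp [hz]
  have hneg : ∀ n : ℕ, (((-ζ ^ n : (𝓞 F)ˣ) : 𝓞 F) : F) = -z ^ n := by
    intro n; simp [hz]
  have hN1 : Algebra.norm F (((((-1 : (𝓞 L)ˣ) : 𝓞 L) : L))) = -1 := by
    have : ((((-1 : (𝓞 L)ˣ) : 𝓞 L) : L)) = algebraMap F L (-1) := by simp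
    rw [this, Algebra.norm_algebraMap, h3]; norm_num
  have key : ∀ (s : F) (n : ℕ), (s = 1 ∨ s = -1) → Algebra.norm F x = s * z ^ n →
      ∃ ε : (𝓞 L)ˣ, Algebra.norm F (((ε : 𝓞 L) : L)) = Algebra.norm F x := by
    intro s n hs hxn
    have hz3 : z ^ 3 = 1 := hζ3
    have hzn : z ^ n = z ^ (n % 3) := by
      conv_lhs => rw [← Nat.div_add_mod n 3, pow_add, pow_mul, hz3, one_pow, one_mul]
    rw [hzn] at hxn
    have hlt : n % 3 < 3 := Nat.mod_lt _ (by norm_num)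
    have hsx : Algebra.norm F ((algebraMap F L s) * x) = z ^ (n % 3) := by
      rw [map_mul, Algebra.norm_algebraMap, h3, hxn]
      rcases hs with rfl | rfl <;> ring
    interval_cases hmod : n % 3
    · rcases hs with rfl | rfl
      · refine ⟨1, ?_⟩
        rw [hxn]; simp
      · refine ⟨-1, ?_⟩
        rw [hN1, hxn]; simp
    · exact absurd (by simpa using hsx) (hnn ((algebraMap F L s) * x))
    · exfalso
      refine hnn (((algebraMap F L s) * x) ^ 2) ?_
      rw [map_pow, hsx, ← pow_mul]
      calc z ^ (2 * 2) = z ^ 3 * z := by ring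
        _ = z := by rw [hz3, one_mul]
  rcases hi with rfl | rfl
  · exact key 1 i (Or.inl rfl) (by rw [hu, hzpow, one_mul])
  · exact key (-1) i (Or.inr rfl) (by rw [hu, hneg]; ring)

/-- **The `(2,5)`-direction of Honda's two-prime criterion** (Honda 1971, Theorem, case (v) /
[AouissiMayerIsmailiTalbiAzizi2020, Thm. 2.3 (5)]): for primes `p ≡ 2`, `q ≡ 5 (mod 9)` and every
cubic number field `K ∋ ∛(pq)`, `3 ∤ h_K`.  Proof (Chevalley's ambiguous classes): in `L = K(ζ₃)`
over `F = ℚ(ζ₃)` exactly the primes above `p` and `q` ramify (totally), `ζ₃` is not a norm from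
`L`, so `#Ĥ⁻¹(σ, 𝓞_Lˣ) = 9`, every `σ`-invariant ideal of `L` is principal, every invariant class
is trivial and `3 ∤ h_L`; but `3 ∣ h_K ⟹ 3 ∣ h_L` since `[L:K] = 2`. [cite: AouissiMayerIsmailiTalbiAzizi2020, Thm. 2.3 item (5)] -/
theorem honda25 (p q : ℕ) (hp : p.Prime) (hq : q.Prime) (hp9 : p % 9 = 2) (hq9 : q % 9 = 5)
    (K : Type) [Field K] [NumberField K] (hK : Module.finrank ℚ K = 3)
    (hα : ∃ α : K, α ^ 3 = ((p * q : ℕ) : K)) : ¬ 3 ∣ classNumber K := by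
  intro h3K
  obtain ⟨L, _, _, _, hKL, hL6, F, hgal, hFL, ⟨σ, hσ⟩, hPID, hcplx, hθ, ζ, hζ3, hζ1, hunits,
    P₁, P₂, hP₁, hP₂, hP12, hspan₁, hspan₂, he₁, h3not, h9⟩ :=
    stub_fieldSetup p q hp hq hp9 hq9 K hK hα
  haveI := hgal
  have h3L : 3 ∣ classNumber L :=
    Literature.NumberTheory.NumberFields.Honda1971.dvd_classNumber_of_dvd_classNumber_of_not_dvd_finrank
      (K := K) (L := L) Nat.prime_three h3K (by rw [hKL]; norm_num)
  have hp3 : p ≠ 3 := by omega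
  have hq3 : q ≠ 3 := by omega
  have hpq : p ≠ q := by omega
  have hpq9 : (p * q) % 9 = 1 := by rw [Nat.mul_mod, hp9, hq9]
  have hζF : ∃ z : F, z ^ 3 = 1 ∧ z ≠ 1 := ⟨((ζ : 𝓞 F) : F), hζ3, hζ1⟩
  have hcensus : ∀ (Q : Ideal (𝓞 L)), Q.IsMaximal →
      Q.ramificationIdx (𝓞 F) ≠ 1 → Q = P₁ ∨ Q = P₂ := by
    intro Q hQ hram
    have key : ∀ {r : ℕ} {P : Ideal (𝓞 L)}, P.IsMaximal →
        Ideal.span {(r : 𝓞 L)} = P ^ 3 → (r : 𝓞 L) ∈ Q → Q = P := by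
      intro r P hP hspan hr
      have hle : P ^ 3 ≤ Q := by
        rw [← hspan, Ideal.span_singleton_le_iff_mem]
        simpa using hr
      have hPQ : P ≤ Q := (Ideal.IsPrime.pow_le_iff (I := P) (hP := hQ.isPrime) (by norm_num)).mp hle
      exact (hP.eq_of_le hQ.ne_top hPQ).symm
    rcases stub_ramificationCensus p q hp hq hp3 hq3 hpq hpq9 L F hL6 hFL hζF hθ Q hQ hram with h | h
    · exact Or.inl (key hP₁ hspan₁ h)
    · exact Or.inr (key hP₂ hspan₂ h)
  have ht₁ : ∃ t : 𝓞 F, Ideal.span {algebraMap (𝓞 F) (𝓞 L) t} = P₁ ^ 3 := ⟨p, by simpa using hspan₁⟩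
  have ht₂ : ∃ t : 𝓞 F, Ideal.span {algebraMap (𝓞 F) (𝓞 L) t} = P₂ ^ 3 := ⟨q, by simpa using hspan₂⟩
  have hnn : ∀ x : L, Algebra.norm F x ≠ ((ζ : 𝓞 F) : F) :=
    stub_zetaNotNorm F L hFL (ζ : 𝓞 F) hζ3 hζ1 P₁ hP₁ he₁ ht₁ h3not h9
  have hu1 : ∀ ε : (𝓞 L)ˣ, Algebra.norm F (((ε : 𝓞 L) : L)) ≠ ((ζ : 𝓞 F) : F) := fun ε => hnn _
  have hu2 : ∀ w : (𝓞 F)ˣ, ∃ i : ℕ, ∃ v : (𝓞 F)ˣ, w = ζ ^ i * v ^ 3 := by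
    intro w
    obtain ⟨i, hi | hi⟩ := hunits w
    · exact ⟨i, 1, by rw [hi]; simp⟩
    · exact ⟨i, -1, by rw [hi]; norm_num⟩
  have hnine := stub_unitsNormOne9 F L σ hσ hFL hcplx ζ hu1 hu2
  have hprinc : ∀ I : Ideal (𝓞 L), I ≠ ⊥ → σ • I = I → Submodule.IsPrincipal I :=
    stub_invariantIdealsPrincipal F L σ hσ hFL hPID P₁ P₂ hP₁ hP₂ hP12 ht₁ ht₂ hcensus hnine
  have hH3 := honda25_norm_unit F L hFL ζ hζ3 hunits hnn
  exact stub_classNumber_not_dvd F L σ hσ hFL hH3 hprinc h3L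

/-- **Honda's criterion on the Φ-hiding promise family** (the idea card's `HondaSplitVsInert`, now a
THEOREM): for distinct primes `p, q` with `pq ≡ 1 (mod 9)` of type "`p ≡ q ≡ 1 (mod 3)`" or
"`{p, q} ≡ {2, 5} (mod 9)`", and every cubic number field `K ∋ ∛(pq)`: `3 ∣ h_K ↔ p ≡ 1 (mod 3)`
— split case by the tree's genus theorem `Honda1971.three_dvd_classNumber_of_mod_three_eq_one`,
inert case by `honda25`. [cite: AouissiMayerIsmailiTalbiAzizi2020, Thm. 2.3 with eq. (2.3)] -/
theorem three_dvd_classNumber_iff_of_promise :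
    ∀ p q : ℕ, p.Prime → q.Prime → p ≠ q → (p * q) % 9 = 1 →
      ((p % 3 = 1 ∧ q % 3 = 1) ∨ (p % 9 = 2 ∧ q % 9 = 5) ∨ (p % 9 = 5 ∧ q % 9 = 2)) →
      ∀ (K : Type) [Field K] [NumberField K], Module.finrank ℚ K = 3 →
        (∃ α : K, α ^ 3 = ((p * q : ℕ) : K)) →
          (3 ∣ classNumber K ↔ p % 3 = 1) := by
  intro p q hp hq hpq _h9 htype K _ _ h3 hα
  rcases htype with ⟨hp1, hq1⟩ | ⟨hp2, hq5⟩ | ⟨hp5, hq2⟩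
  · obtain ⟨α, hα⟩ := hα
    exact ⟨fun _ => hp1, fun _ =>
      Literature.NumberTheory.NumberFields.Honda1971.three_dvd_classNumber_of_mod_three_eq_one
        hp hq hpq (Or.inl hp1) K h3 hα⟩
  · refine ⟨fun h => absurd h (honda25 p q hp hq hp2 hq5 K h3 hα), fun h => by omega⟩
  · refine ⟨fun h => absurd h (honda25 q p hq hp hq2 hp5 K h3 ?_), fun h => by omega⟩
    obtain ⟨α, hα⟩ := hα
    exact ⟨α, by rw [hα, Nat.mul_comm]⟩

/-! ### The reduction, now hypothesis-free, and the transfer from Φ-hiding alone -/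

/-- **THE REDUCTION, unconditional** (C2 of the idea card; compare
`eisensteinTypeDecider_of_classNumberAlgorithm`, which assumed Honda's full criterion): a PPT
algorithm for the class-number bits yields a PPT decider of the hidden Eisenstein type
`[p ≡ 1 (mod 3)]` on the promise family, via `three_dvd_classNumber_iff_of_promise`, the window
`2|x|+8 > log₂ h_K` and the `FP` post-processing `[3 ∣ ⟦output⟧]`. [folklore] -/
theorem eisensteinTypeDecider_of_classNumberAlgorithm'
    (hA : ∃ A : RandAlg (List Bool) (List Bool), A.IsPolyTime id id ∧
      ∀ (x : List Bool) (K : Type) [Field K] [NumberField K], Module.finrank ℚ K = 3 →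
        (∀ r : ℕ, r ^ 3 ≠ decodeNat x) → (∃ α : K, α ^ 3 = (decodeNat x : K)) →
          (2 : ℝ) / 3 ≤ A.pr id x
            {List.ofFn (fun i : Fin (2 * x.length + 8) => (classNumber K).testBit i.val)}) :
    ∃ D : RandAlg (List Bool) Bool, D.IsPolyTime id encodeBool ∧
      ∀ p q : ℕ, p.Prime → q.Prime → p ≠ q → (p * q) % 9 = 1 →
        ((p % 3 = 1 ∧ q % 3 = 1) ∨ (p % 9 = 2 ∧ q % 9 = 5) ∨ (p % 9 = 5 ∧ q % 9 = 2)) →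
        (2 : ℝ) / 3 ≤ D.pr id (encodeNat (p * q)) {b | b = decide (p % 3 = 1)} := by
  obtain ⟨A, hApt, hAcorr⟩ := hA
  refine ⟨{ run := fun x r => decide (bitsToNat (A.run x r) % 3 = 0), coinLen := A.coinLen },
    isPolyTime_modThree hApt, ?_⟩
  intro p q hp hq hpq h9 htype
  have hm : decodeNat (encodeNat (p * q)) = p * q := decode_encodeNat _
  have hnc : ∀ r : ℕ, r ^ 3 ≠ decodeNat (encodeNat (p * q)) := by
    rw [hm]; exact not_cube_mul_prime hp hq hpq
  obtain ⟨K, _, _, h3, hα⟩ := factsExists (p * q) (not_cube_mul_prime hp hq hpq)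
  have hα' : ∃ α : K, α ^ 3 = (decodeNat (encodeNat (p * q)) : K) := by rw [hm]; exact hα
  have hAK := hAcorr (encodeNat (p * q)) K h3 hnc hα'
  have hh : 3 ∣ classNumber K ↔ p % 3 = 1 :=
    three_dvd_classNumber_iff_of_promise p q hp hq hpq h9 htype K h3 hα
  have hlt : classNumber K < 2 ^ (2 * (encodeNat (p * q)).length + 8) :=
    classNumber_lt_window (encodeNat (p * q)) K h3 hnc hα'
  refine hAK.trans (pr_singleton_le_pr_modThree A _ _ _ ?_)
  rw [bitsToNat_ofFn_testBit hlt]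
  refine decide_eq_decide.mpr ⟨fun h0 => hh.mp (by omega), fun h1 => ?_⟩
  have := hh.mpr h1
  omega

/-- **THE TRANSFER FROM Φ-HIDING ALONE.** The crux `PureCubicClassNumberHard` follows from the
single hypothesis "worst-case Φ-hiding for the fixed exponent `e = 3` on the pure-cubic promise
family": no PPT algorithm decides, for every `N = pq ≡ 1 (mod 9)` with `p ≡ q ≡ 1 (mod 3)` or
`{p, q} ≡ {2, 5} (mod 9)`, whether `p ≡ 1 (mod 3)` (equivalently `3 ∣ φ(N)`) with probability
`≥ 2/3` — an OPEN hardness hypothesis (a worst-case, fixed-exponent analogue of the average-case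
Φ-Hiding Assumption of Cachin–Micali–Stadler 1999 §2), explicit as `hΦ` and NOT asserted.  The
number-theoretic input (Honda's criterion on that family) is now PROVED, so compared with
`pureCubicClassNumberHard_of_honda_of_phiHiding3` the named fact has left the hypotheses. [folklore] -/
theorem pureCubicClassNumberHard_of_phiHiding3
    (hΦ : ¬ ∃ D : RandAlg (List Bool) Bool, D.IsPolyTime id encodeBool ∧
      ∀ p q : ℕ, p.Prime → q.Prime → p ≠ q → (p * q) % 9 = 1 →
        ((p % 3 = 1 ∧ q % 3 = 1) ∨ (p % 9 = 2 ∧ q % 9 = 5) ∨ (p % 9 = 5 ∧ q % 9 = 2)) →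
        (2 : ℝ) / 3 ≤ D.pr id (encodeNat (p * q)) {b | b = decide (p % 3 = 1)}) :
    Theses.LinnikCubicClassGroups.PureCubicClassNumberHard :=
  fun hA => hΦ (eisensteinTypeDecider_of_classNumberAlgorithm' hA)

end Summit.QuantumAdvantage.QuantumAdvantage.Theorems.LinnikCubicClassGroups
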